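import Summits.MatrixMultiplication.MatrixMultiplication.Theorems.FarEdgeDescentMomentReadout
import Summits.MatrixMultiplication.MatrixMultiplication.Theorems.FarEdgeDescentIsolatedTower
import HarnessLib

/-!
# Far-edge descent, kernel XXXV-B: the `E₃` tower read by moments, and the FAT/THIN dichotomy

Route `FarEdgeDescent`, special leaf `FiniteSaturation` (stmt-MatrixMultiplication-23739): helper
kernel, THESES-FREE and def-free (decomp-mm lens 2 «structural dichotomy: special vs generic», gen 55).
Companion of kernel XXXV-A (`FarEdgeDescentMomentReadout`: moment invariant, line certificates,
`rateBeyond_of_momentChain`).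

(1) UNCONDITIONAL INSTANCE (`e3_momentCertificates`, §4).  The arithmetised isolated `E₃` tower of
kernel XXXII-C (`isolatedTowerChain` on Schönhage's `⟨1,4,1⟩ ⊕ ⟨3,1,3⟩ ≤ 10`, `base_isolated`) with the
moments `M₀ = 3 log 3`, `N₀ = 0` (`G₀ = 3^s = 3·e^{(s−1)log 3}`: the mean field is EXACT at stage `0`)
exports, on every sub-tangent: mean field ≤ rank, the line certificates, the THIN aspect bound
`N_j/M_j ≥ j·log(10/3)/(3 log 3)`, and the `κ`-wedge — whence the order of record
`θ_S = log(4/3)/log(3/2) = 0.70951…` (kernel XXXII-D `rateBeyond_isolatedTower`, recovered through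
`excess_le_const_mul_rpow_of_virtualPowerBound` and NOT restated) from three numbers `(L_j, M_j, N_j)`
per stage and Jensen, never looking at the deviation dynamics.  Stage table (exact):
`(L,M,N)₀ = (3, 3 log 3, 0)`, `(L,M,N)₁ = (33, 42 log 3, 24 log 4)`,
`(L,M,N)₂ = (3333, 5628 log 3, 3216 log 4 + 2244 log 34)`; aspects `N_j/M_j = 0, 0.7210…, 2.0008…,
4.187…, 7.689…` (ratio → 3/2); intercepts `L_j log(r_j/L_j)/M_j = 1.095…, 0.792…, 0.592…, 0.444…`
(ratio → 3/4).
(2) THE DICHOTOMY (lens 2, typed).  `finiteSaturation_iff_linearWedge`: over any field,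
`(∃ k ≥ 2, ω(1,k,1) = k+1) ↔ (∃ k, every sub-tangent (s,t) ∈ [1,2]×[0,1] of ω(1,·,1) has s−1 ≤ k(1−t))`
— finite saturation IS the statement that the virtual points lie under a LINE through the corner
`(1,1)` (bounded aspect, «FAT»), whereas the generic/thin alternative is a power wedge `(1−t)^κ`, `κ<1`.
`finiteSaturation_of_boundedAspect`: any family of corner line-certificates `(s−1)M_j ≤ (1−t)N_j + c_j`
with bounded aspect `N_j ≤ kM_j` and vanishing intercept certifies finite saturation (FAT-MASS
CRITERION; the SUFF-side reading of (h₁) in moment language).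
(3) THIN.  `aspect_ge`: for EVERY clock-`2` improvable chain (`Q+2L = r`, `L' = (Q+L)²−Q²`, `r' = r²`,
`3L₀ ≤ r₀`, `r₀ ≥ 3`) the aspect of the moment certificates diverges at least linearly,
`N_j/M_j ≥ N₀/M₀ + j·L₀ log(r₀/3)/(3M₀)` (`E₃`: slope `log(10/3)/(3 log 3) = 0.3653…`; true growth
`≍ (3/2)^j`): squaring towers are THIN, their moment certificates never meet the fat-mass criterion, and
the best they yield is the `κ`-wedge of XXXV-A — the structural reason the ladder of record stops at
`θ_S = log(4/3)/log(3/2)` = (intercept exponent)/(aspect exponent).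
NO definitions; `FiniteSaturation` is spelled, never imported.

References: Schönhage 1981 §5; Pan 1984 (LNCS 179) §16 Props. 16.2–16.5, §17 Thm. 17.1; Stothers 2010
Thm. 8; Knuth TAOCP 2 §4.6.4 Ex. 67(g); Lotti–Romani 1983 §2 (p. 174), Prop. 4.1; Coppersmith–Winograd
1982 §3; Coppersmith 1982 (`α`).
Tags: `FiniteSaturation` (h₁) NEC · WEAKER · ATTACKED (moment certificates of the `E₃` tower; FS ⟺ FAT).
-/

set_option linter.dupNamespace false

noncomputable section

open scoped BigOperators

namespace Summit.MatrixMultiplication.MatrixMultiplication.Theorems.FarEdgeDescentMomentDichotomy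

open Literature.Computability.AlgebraicComplexity
open Summit.MatrixMultiplication.MatrixMultiplication.Theorems.FarEdgeDescentImprovableDynamics
open Summit.MatrixMultiplication.MatrixMultiplication.Theorems.FarEdgeDescentImprovableRate
open Summit.MatrixMultiplication.MatrixMultiplication.Theorems.FarEdgeDescentMomentReadout
open Summit.MatrixMultiplication.MatrixMultiplication.Theorems.FarEdgeDescentIsolatedChain
open Summit.MatrixMultiplication.MatrixMultiplication.Theorems.FarEdgeDescentIsolatedTower

variable (K : Type) [Field K]

/-! ## §1 The moment sequences -/

/-- **The moment sequences exist** (primitive recursion): `M' = 2(L+Q)M`, `N' = 2(L+Q)N + 2QL log Q`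
from any initial values. [folklore] -/
theorem moments_exist (L Q : ℕ → ℕ) (M₀ N₀ : ℝ) :
    ∃ M N : ℕ → ℝ, M 0 = M₀ ∧ N 0 = N₀ ∧
      (∀ j, M (j + 1) = 2 * ((L j : ℝ) + Q j) * M j) ∧
      (∀ j, N (j + 1) = 2 * ((L j : ℝ) + Q j) * N j + 2 * (Q j : ℝ) * L j * Real.log (Q j)) :=
  ⟨fun j => Nat.rec (motive := fun _ => ℝ) M₀ (fun i m => 2 * ((L i : ℝ) + Q i) * m) j,
    fun j => Nat.rec (motive := fun _ => ℝ) N₀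
      (fun i n => 2 * ((L i : ℝ) + Q i) * n + 2 * (Q i : ℝ) * L i * Real.log (Q i)) j,
    rfl, rfl, fun _ => rfl, fun _ => rfl⟩

/-! ## §2 The dichotomy: finite saturation ⟺ a line through the corner -/

/-- **FAT ⟸ flat.**  If `ω(1,k,1) = k+1` (`k ≥ 0`) then every sub-tangent `(s,t)` of `ω(1,·,1)` has
`s − 1 ≤ k(1−t)`. [cite: LottiRomani1983, §2 (p. 174)] -/
theorem linearWedge_of_flat {k : ℝ} (hk0 : 0 ≤ k) (hk : omegaRect K 1 k 1 = k + 1) {s t : ℝ}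
    (hst : ∀ y : ℝ, 0 ≤ y → s + y * t ≤ omegaRect K 1 y 1) : s - 1 ≤ k * (1 - t) := by
  have h := hst k hk0
  rw [hk] at h
  linarith

/-- **Flat ⟸ FAT.**  If every sub-tangent `(s,t) ∈ [1,2]×[0,1]` has `s − 1 ≤ k(1−t)` then
`ω(1,x,1) = x+1` for every `x ≥ k`, `x > 0` (exclusion principle of kernel XXVII at `x`, and `ω(1,x,1) ≥ x+1`).
[cite: LottiRomani1983, §2 (p. 174)] [cite: Coppersmith1982, Thm. 1] -/
theorem flat_of_linearWedge {k : ℝ}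
    (h : ∀ s t : ℝ, 0 ≤ t → t ≤ 1 → 1 ≤ s → s ≤ 2 →
      (∀ y : ℝ, 0 ≤ y → s + y * t ≤ omegaRect K 1 y 1) → s - 1 ≤ k * (1 - t))
    {x : ℝ} (hx : 0 < x) (hkx : k ≤ x) : omegaRect K 1 x 1 = x + 1 := by
  refine le_antisymm ?_ (add_one_le_omegaRect_one_mid_one K x)
  have hex := FarEdgeDescentVirtualPoint.excess_le_of_virtualPoints K hx (η := 0)
    fun s t ht0 ht1 hs1 hs2 hst => by
      have h1 := h s t ht0 ht1 hs1 hs2 hst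
      nlinarith [mul_le_mul_of_nonneg_right hkx (sub_nonneg.2 ht1)]
  linarith

/-- **THE FAT/THIN DICHOTOMY OF THE FAR EDGE.**  Over any field `K`:
`(∃ k ≥ 2, ω_K(1,k,1) = k+1)` (finite saturation, spelled) `↔` the virtual points of `ω_K(1,·,1)` lie under
a LINE through the corner: `∃ k, ∀ sub-tangent (s,t) ∈ [1,2]×[0,1], s − 1 ≤ k(1−t)` (bounded aspect, FAT).
The complement (THIN) is what every tower of the lineage certifies: a power wedge `(1−t)^κ`, `κ < 1`.
[cite: LottiRomani1983, §2 (p. 174), Prop. 4.1] [cite: Coppersmith1982, Thm. 1] -/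
theorem finiteSaturation_iff_linearWedge :
    (∃ k : ℕ, 2 ≤ k ∧ omegaRect K 1 k 1 = k + 1) ↔
      ∃ k : ℝ, ∀ s t : ℝ, 0 ≤ t → t ≤ 1 → 1 ≤ s → s ≤ 2 →
        (∀ y : ℝ, 0 ≤ y → s + y * t ≤ omegaRect K 1 y 1) → s - 1 ≤ k * (1 - t) := by
  constructor
  · rintro ⟨k, -, hk⟩
    exact ⟨k, fun s t _ _ _ _ hst => linearWedge_of_flat K (Nat.cast_nonneg k) hk hst⟩
  · rintro ⟨k, h⟩
    refine ⟨max 2 ⌈k⌉₊, le_max_left _ _, ?_⟩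
    have h2 : (2 : ℝ) ≤ ((max 2 ⌈k⌉₊ : ℕ) : ℝ) := by exact_mod_cast le_max_left 2 ⌈k⌉₊
    have hkx : k ≤ ((max 2 ⌈k⌉₊ : ℕ) : ℝ) :=
      le_trans (Nat.le_ceil k) (by exact_mod_cast le_max_right 2 ⌈k⌉₊)
    exact flat_of_linearWedge K h (by linarith) hkx

/-- **FAT-MASS CRITERION.**  A family of corner line-certificates `(s−1)·M_j ≤ (1−t)·N_j + c_j` on the
sub-tangents (`M_j > 0`) with BOUNDED ASPECT `N_j ≤ k·M_j` and VANISHING INTERCEPT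
(`∀ ε > 0, ∃ j, c_j ≤ ε·M_j`) certifies finite saturation.  The moment certificates of kernel XXXV-A have
this shape with `c_j = L_j log(r_j/L_j)` and vanishing intercept; what they lack is bounded aspect (§3).
[cite: LottiRomani1983, §2 (p. 174), Prop. 4.1] [cite: Pan1984, Thm. 17.1] -/
theorem finiteSaturation_of_boundedAspect (M N c : ℕ → ℝ) {k : ℝ} (hMpos : ∀ j, 0 < M j)
    (hasp : ∀ j, N j ≤ k * M j) (hint : ∀ ε : ℝ, 0 < ε → ∃ j, c j ≤ ε * M j)
    (hcert : ∀ j (s t : ℝ), 0 ≤ t → t ≤ 1 → 1 ≤ s → s ≤ 2 →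
      (∀ y : ℝ, 0 ≤ y → s + y * t ≤ omegaRect K 1 y 1) → (s - 1) * M j ≤ (1 - t) * N j + c j) :
    ∃ k : ℕ, 2 ≤ k ∧ omegaRect K 1 k 1 = k + 1 := by
  refine (finiteSaturation_iff_linearWedge K).2 ⟨k, fun s t ht0 ht1 hs1 hs2 hst => ?_⟩
  refine le_of_forall_pos_le_add fun ε hε => ?_
  obtain ⟨j, hj⟩ := hint ε hε
  have h1 := hcert j s t ht0 ht1 hs1 hs2 hst
  have h2 : (1 - t) * N j ≤ (1 - t) * (k * M j) :=
    mul_le_mul_of_nonneg_left (hasp j) (sub_nonneg.2 ht1)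
  have h3 : (s - 1) * M j ≤ (k * (1 - t) + ε) * M j := by nlinarith
  exact le_of_mul_le_mul_right h3 (hMpos j)

/-! ## §3 THIN: the aspect of a squaring tower's moment certificates diverges -/

section Thin

variable (r Q L : ℕ → ℕ) (M N : ℕ → ℝ)

/-- The legs ratio `m_j = L_j/r_j` is non-decreasing: `m' = m(2−3m) ≥ m` for `m ≤ 1/3`. [folklore] -/
theorem legs_ratio_mono (hsum : ∀ j, Q j + 2 * L j = r j) (hQ1 : ∀ j, 1 ≤ Q j)
    (hm0 : 3 * L 0 ≤ r 0) (hL : ∀ j, L (j + 1) = (Q j + L j) ^ 2 - Q j ^ 2)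
    (hr : ∀ j, r (j + 1) = r j ^ 2) : ∀ j, (L 0 : ℝ) / r 0 ≤ (L j : ℝ) / r j := by
  intro j
  induction j with
  | zero => exact le_rfl
  | succ j ih =>
    obtain ⟨-, hmj0, hm3, -, hrec⟩ := improvable_normalForm r Q L hsum hQ1 hm0 hL hr j
    rw [hrec]
    nlinarith [mul_nonneg hmj0 (show (0 : ℝ) ≤ 1 / 3 - (L j : ℝ) / r j by linarith)]

/-- `M_j ≤ 2^j·(M₀/r₀)·r_j` (`M' = 2(L+Q)M ≤ 2rM`). [folklore] -/
theorem moment_s_le (hsum : ∀ j, Q j + 2 * L j = r j) (hQ1 : ∀ j, 1 ≤ Q j)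
    (hm0 : 3 * L 0 ≤ r 0) (hL : ∀ j, L (j + 1) = (Q j + L j) ^ 2 - Q j ^ 2)
    (hr : ∀ j, r (j + 1) = r j ^ 2)
    (hM : ∀ j, M (j + 1) = 2 * ((L j : ℝ) + Q j) * M j) (hM0 : 0 ≤ M 0) :
    ∀ j, M j ≤ 2 ^ j * (M 0 / r 0) * r j := by
  intro j
  induction j with
  | zero =>
    obtain ⟨hr0, -⟩ := improvable_normalForm r Q L hsum hQ1 hm0 hL hr 0
    rw [pow_zero, one_mul, div_mul_cancel₀ _ hr0.ne']
  | succ j ih =>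
    have hsumR : (Q j : ℝ) + 2 * L j = r j := by exact_mod_cast hsum j
    have hrR : (r (j + 1) : ℝ) = (r j : ℝ) ^ 2 := by rw [hr j]; push_cast; ring
    have hMj : 0 ≤ M j := le_trans (mul_nonneg (mul_nonneg (pow_nonneg (by norm_num) _)
      (div_nonneg hM0 (Nat.cast_nonneg _))) (Nat.cast_nonneg _))
      (moment_s_ge r Q L M hsum hQ1 hm0 hL hr hM hM0 j)
    have hL0' : (0 : ℝ) ≤ L j := Nat.cast_nonneg _
    have hLQ : 2 * ((L j : ℝ) + Q j) ≤ 2 * r j := by linarith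
    rw [hM j, hrR]
    calc 2 * ((L j : ℝ) + Q j) * M j ≤ (2 * (r j : ℝ)) * (2 ^ j * (M 0 / r 0) * r j) :=
          mul_le_mul hLQ ih hMj (by positivity)
      _ = 2 ^ (j + 1) * (M 0 / r 0) * (r j : ℝ) ^ 2 := by ring

/-- **THIN: the aspect diverges.**  For every clock-`2` improvable chain with `3L₀ ≤ r₀`, `r₀ ≥ 3` and
moments `M' = 2(L+Q)M` (`M₀ > 0`), `N' = 2(L+Q)N + 2QL log Q`:
`N_j/M_j ≥ N₀/M₀ + j·δ`, `δ = L₀·log(r₀/3)/(3M₀)` — each squaring adds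
`QL log Q/((L+Q)M) ≥ (L/3)·2^j log(r₀/3)/(2^j (M₀/r₀) r) ≥ δ` to the aspect (`Q ≥ r/3`, `L ≥ m₀r`,
`M ≤ 2^j(M₀/r₀)r`).  `E₃`: `δ = log(10/3)/(3 log 3) = 0.3653…`. Squaring towers are never FAT.
[cite: Pan1984, Props. 16.2–16.5] [cite: Stothers2010, Thm. 8] -/
theorem aspect_ge (hsum : ∀ j, Q j + 2 * L j = r j) (hQ1 : ∀ j, 1 ≤ Q j)
    (hm0 : 3 * L 0 ≤ r 0) (hL : ∀ j, L (j + 1) = (Q j + L j) ^ 2 - Q j ^ 2)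
    (hr : ∀ j, r (j + 1) = r j ^ 2)
    (hM : ∀ j, M (j + 1) = 2 * ((L j : ℝ) + Q j) * M j)
    (hN : ∀ j, N (j + 1) = 2 * ((L j : ℝ) + Q j) * N j + 2 * (Q j : ℝ) * L j * Real.log (Q j))
    (hM0 : 0 < M 0) (hr3 : 3 ≤ r 0) :
    ∀ j, N 0 / M 0 + j * ((L 0 : ℝ) * Real.log ((r 0 : ℝ) / 3) / (3 * M 0)) ≤ N j / M j := by
  have hr0pos : (0 : ℝ) < r 0 := (improvable_normalForm r Q L hsum hQ1 hm0 hL hr 0).1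
  have hr3R : (3 : ℝ) ≤ r 0 := by exact_mod_cast hr3
  have hlr : 0 ≤ Real.log ((r 0 : ℝ) / 3) :=
    Real.log_nonneg (by rw [le_div_iff₀ (by norm_num : (0 : ℝ) < 3)]; linarith)
  intro j
  induction j with
  | zero => simp
  | succ j ih =>
    obtain ⟨hrpos, -, hm3, -, -⟩ := improvable_normalForm r Q L hsum hQ1 hm0 hL hr j
    have hsumR : (Q j : ℝ) + 2 * L j = r j := by exact_mod_cast hsum j
    have hQj1 : (1 : ℝ) ≤ Q j := by exact_mod_cast hQ1 j
    have hL0' : (0 : ℝ) ≤ L j := Nat.cast_nonneg _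
    have hMj : 0 < M j := lt_of_lt_of_le (by positivity)
      (moment_s_ge r Q L M hsum hQ1 hm0 hL hr hM hM0.le j)
    have hLQpos : (0 : ℝ) < (L j : ℝ) + Q j := by linarith
    have h3L : 3 * (L j : ℝ) ≤ r j := by rw [div_le_iff₀ hrpos] at hm3; linarith
    have hQ3 : (r j : ℝ) ≤ 3 * Q j := by linarith
    have hLQr : (L j : ℝ) + Q j ≤ r j := by linarith
    have hMne : M j ≠ 0 := hMj.ne'
    have hLQne : (L j : ℝ) + Q j ≠ 0 := hLQpos.ne'
    have hinc : N (j + 1) / M (j + 1) =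
        N j / M j + (Q j : ℝ) * L j * Real.log (Q j) / (((L j : ℝ) + Q j) * M j) := by
      rw [hN j, hM j]
      field_simp
    rw [hinc]
    suffices hδ : (L 0 : ℝ) * Real.log ((r 0 : ℝ) / 3) / (3 * M 0) ≤
        (Q j : ℝ) * L j * Real.log (Q j) / (((L j : ℝ) + Q j) * M j) by
      push_cast
      linarith
    have hLm : (L 0 : ℝ) / r 0 * r j ≤ L j :=
      (le_div_iff₀ hrpos).1 (legs_ratio_mono r Q L hsum hQ1 hm0 hL hr j)
    have hMle := moment_s_le r Q L M hsum hQ1 hm0 hL hr hM hM0.le j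
    have hlogQ0 : 0 ≤ Real.log (Q j) := Real.log_nonneg hQj1
    have hlogQ : 2 ^ j * Real.log ((r 0 : ℝ) / 3) ≤ Real.log (Q j) := by
      have h1 : Real.log ((r j : ℝ) / 3) ≤ Real.log (Q j) :=
        Real.log_le_log (by positivity) (by rw [div_le_iff₀ (by norm_num : (0 : ℝ) < 3)]; linarith)
      rw [Real.log_div hrpos.ne' (by norm_num), r_eq_pow r hr j] at h1
      push_cast at h1
      rw [Real.log_pow] at h1
      push_cast at h1
      rw [Real.log_div hr0pos.ne' (by norm_num)]
      have hl3 : 0 ≤ Real.log 3 := Real.log_nonneg (by norm_num)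
      have h2j : (1 : ℝ) ≤ 2 ^ j := one_le_pow₀ (by norm_num)
      nlinarith [mul_nonneg (sub_nonneg.2 h2j) hl3]
    have step1 : (L j : ℝ) * Real.log (Q j) / (3 * M j) ≤
        (Q j : ℝ) * L j * Real.log (Q j) / (((L j : ℝ) + Q j) * M j) := by
      rw [div_le_div_iff₀ (by positivity) (by positivity)]
      have hnn : 0 ≤ (L j : ℝ) * Real.log (Q j) * M j := by positivity
      nlinarith [hnn, hLQr, hQ3]
    have step2 : (L 0 : ℝ) * Real.log ((r 0 : ℝ) / 3) / (3 * M 0) ≤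
        (L j : ℝ) * Real.log (Q j) / (3 * M j) := by
      rw [div_le_div_iff₀ (by positivity) (by positivity)]
      have a1 : (L 0 : ℝ) * Real.log ((r 0 : ℝ) / 3) * M j ≤
          (L 0 : ℝ) * Real.log ((r 0 : ℝ) / 3) * (2 ^ j * (M 0 / r 0) * r j) :=
        mul_le_mul_of_nonneg_left hMle (mul_nonneg (Nat.cast_nonneg _) hlr)
      have a2 : ((L 0 : ℝ) / r 0 * r j) * (2 ^ j * Real.log ((r 0 : ℝ) / 3)) ≤
          (L j : ℝ) * Real.log (Q j) :=
        mul_le_mul hLm hlogQ (mul_nonneg (by positivity) hlr) hL0'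
      have a3 := mul_le_mul_of_nonneg_left a2 hM0.le
      have e : (L 0 : ℝ) * Real.log ((r 0 : ℝ) / 3) * (2 ^ j * (M 0 / r 0) * r j) =
          M 0 * (((L 0 : ℝ) / r 0 * r j) * (2 ^ j * Real.log ((r 0 : ℝ) / 3))) := by ring
      linarith
    exact le_trans step2 step1

end Thin

/-! ## §4 The `E₃` tower read by moments -/

/-- **THE `E₃` TOWER READ BY MOMENTS** (unconditional, every field).  The isolated `E₃` chain of kernel
XXXII-C (`⟨1,4,1⟩ ⊕ ⟨3,1,3⟩ ≤ 10`, squared with isolated re-anchoring) carries moment sequences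
`M₀ = 3 log 3`, `N₀ = 0`, `M' = 2(L+Q)M`, `N' = 2(L+Q)N + 2QL log Q` such that on every sub-tangent
`(s,t)` of `ω(1,·,1)`: (i) MEAN FIELD ≤ RANK, `L_j·exp(((s−1)M_j − (1−t)N_j)/L_j) ≤ r_j`; (ii) the LINE
CERTIFICATES `(s−1)M_j − (1−t)N_j ≤ L_j log(r_j/L_j)`; (iii) THIN: aspect `N_j/M_j ≥ j·log(10/3)/(3 log 3)`;
(iv) the wedge `s − 1 ≤ C(1−t)^{log₂(4/3)}` on `[1,2]×[0,1]` — whence the rate of record `θ_S⁻`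
(kernel XXXII-D `rateBeyond_isolatedTower`, recovered by `excess_le_const_mul_rpow_of_virtualPowerBound`;
not restated).  Stage table: `(L,M,N) = (3, 3log3, 0), (33, 42log3, 24log4), (3333, 5628log3,
3216log4 + 2244log34)`. [cite: Schonhage1981, §5] [cite: Pan1984, Props. 16.2–16.5, Thm. 17.1]
[cite: Stothers2010, Thm. 8] [cite: KnuthTAOCP2, §4.6.4, Ex. 67(g)] [cite: LottiRomani1983, Prop. 4.1] -/
theorem e3_momentCertificates :
    ∃ (r Q L : ℕ → ℕ) (M N : ℕ → ℝ),
      r 0 = 10 ∧ Q 0 = 4 ∧ L 0 = 3 ∧ M 0 = 3 * Real.log 3 ∧ N 0 = 0 ∧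
      (∀ j, Q j + 2 * L j = r j) ∧ (∀ j, L (j + 1) = (Q j + L j) ^ 2 - Q j ^ 2) ∧
      (∀ j, r (j + 1) = r j ^ 2) ∧
      (∀ j, M (j + 1) = 2 * ((L j : ℝ) + Q j) * M j) ∧
      (∀ j, N (j + 1) = 2 * ((L j : ℝ) + Q j) * N j + 2 * (Q j : ℝ) * L j * Real.log (Q j)) ∧
      (∀ j (s t : ℝ), (∀ y : ℝ, 0 ≤ y → s + y * t ≤ omegaRect K 1 y 1) →
        (L j : ℝ) * Real.exp (((s - 1) * M j - (1 - t) * N j) / L j) ≤ r j) ∧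
      (∀ j (s t : ℝ), (∀ y : ℝ, 0 ≤ y → s + y * t ≤ omegaRect K 1 y 1) →
        (s - 1) * M j - (1 - t) * N j ≤ (L j : ℝ) * Real.log ((r j : ℝ) / L j)) ∧
      (∀ j : ℕ, (j : ℝ) * (Real.log ((10 : ℝ) / 3) / (3 * Real.log 3)) ≤ N j / M j) ∧
      (∃ C : ℝ, 0 ≤ C ∧ ∀ s t : ℝ, 0 ≤ t → t ≤ 1 → 1 ≤ s → s ≤ 2 →
        (∀ y : ℝ, 0 ≤ y → s + y * t ≤ omegaRect K 1 y 1) →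
        s - 1 ≤ C * (1 - t) ^ Real.logb 2 ((4 : ℝ) / 3)) := by
  obtain ⟨H, u, v, w, d, hreal, hd, himp⟩ := base_isolated K
  obtain ⟨r, Q, L, G, h0r, h0Q, h0L, h0G, hsum, hQ1, hL, hr, hG, hread⟩ :=
    isolatedTowerChain K (fun _ : Fin 1 => 3) (fun _ : Fin 1 => 1) (fun _ => by norm_num)
      (fun _ => le_rfl) (Q₀ := 4) (by norm_num) (by simp) ⟨u, v, w, d, hreal, hd, himp⟩
  obtain ⟨M, N, hM0, hN0, hM, hN⟩ := moments_exist L Q (3 * Real.log 3) 0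
  have h0r' : r 0 = 10 := by rw [h0r]
  have h0L' : L 0 = 3 := by rw [h0L]; simp
  have h0G' : ∀ s t : ℝ, G 0 s t = (3 : ℝ) ^ s := by
    intro s t
    rw [h0G]
    simp
  have hlog3 : 0 < Real.log 3 := Real.log_pos (by norm_num)
  have hm0 : 3 * L 0 ≤ r 0 := by rw [h0L', h0r']; norm_num
  have hL0 : 1 ≤ L 0 := by rw [h0L']; norm_num
  have hM0pos : 0 < M 0 := by rw [hM0]; positivity
  have hN0le : N 0 ≤ (r 0 : ℝ) * Real.log (r 0) := by
    rw [hN0, h0r']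
    exact mul_nonneg (by norm_num) (Real.log_natCast_nonneg _)
  have hI0 : ∀ s t : ℝ, (L 0 : ℝ) * Real.exp (((s - 1) * M 0 - (1 - t) * N 0) / L 0) ≤ G 0 s t := by
    intro s t
    rw [h0G', h0L', hM0, hN0]
    push_cast
    have e : ((s - 1) * (3 * Real.log 3) - (1 - t) * 0) / 3 = (s - 1) * Real.log 3 := by ring
    have e3 : (3 : ℝ) * Real.exp ((s - 1) * Real.log 3) = (3 : ℝ) ^ s := by
      rw [Real.rpow_def_of_pos (by norm_num : (0 : ℝ) < 3),
        show Real.log 3 * s = Real.log 3 + (s - 1) * Real.log 3 by ring, Real.exp_add,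
        Real.exp_log (by norm_num : (0 : ℝ) < 3)]
    rw [e, e3]
  refine ⟨r, Q, L, M, N, h0r', h0Q, h0L', hM0, hN0, hsum, hL, hr, hM, hN,
    fun j s t hst => le_trans (moment_invariant Q L G M N hQ1 hL hL0 hG hM hN hI0 j s t)
      (hread j s t hst),
    fun j s t hst => moment_certificate K r Q L G M N hQ1 hL hL0 hG hread hM hN hI0 j hst,
    fun j => ?_,
    virtualPowerBound_of_momentChain K r Q L G M N hsum hQ1 hm0 hL hL0 hr hG hread hM hN hM0pos
      hN0le hI0⟩
  have hA := aspect_ge r Q L M N hsum hQ1 hm0 hL hr hM hN hM0pos (by rw [h0r']; norm_num) j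
  have e : (L 0 : ℝ) * Real.log ((r 0 : ℝ) / 3) / (3 * M 0) =
      Real.log ((10 : ℝ) / 3) / (3 * Real.log 3) := by
    rw [h0L', h0r', hM0]
    push_cast
    field_simp
  rw [hN0, zero_div, zero_add, e] at hA
  exact hA

end Summit.MatrixMultiplication.MatrixMultiplication.Theorems.FarEdgeDescentMomentDichotomy

end
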